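import Literature.AnabelianGeometry.EtaleTheta.Discharge.Sec2EnvelopeLemmas
import Literature.AnabelianGeometry.EtaleTheta.MonoThetaEnv
import Mathlib.Data.Fintype.Card

/-!
# [EtTh] Prop 2.14 (iii), BI-THETA case: the cocycle criterion — every automorphism of the model bi-theta
# environment `B(η)` over `φ` transforms `η` into `η` up to a coboundary (proof-only companion)

Mochizuki, *The Étale Theta Function and its Frobenioid-theoretic Manifestations* [EtTh], Publ. RIMS 45
(2009), §2, Prop 2.14 (iii) pp.49–51 (locators `p.N` = PDF pages of the PRIMS text; bib key
`MochizukiEtTh2009`). PROOF-ONLY companion (no `def`) of `MonoThetaEnv.lean` (`ThetaEnvData.modelBi`,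
Def 2.13 (iii)) and `ThetaRigidity.lean` (`RigidData.Prop214_iii_bi`) — seat abc-iut-L2-t2, §2 owner; the
converse of `Discharge/Sec2BiThetaAutLift.lean` (`ThetaEnvData.exists_biIso_over_aut`).

PRINT (Prop 2.14 (iii), proof, pp.50–51): the lower bound "if … `t^Θ_Ÿ` is obtained as an
`N·(l·ℤ)`-conjugate of `s^Θ_Ÿ`, then the cocycle `δ` is a coboundary; in particular, [in this case] the
automorphism `α_δ` preserves the `μ_N`-conjugacy classes of subgroups determined by the images of `s^Θ_Ÿ`,
`t^Θ_Ÿ`, `s^alg_Ÿ`", and the upper bound "On the other hand, the fact that `Im_N ⊆ (N†·l·ℤ) ⋊ {±1}`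
follows immediately by considering, in light of the cohomology computation of Proposition 1.5, (i), the
third displayed formula of Proposition 1.4, (ii), applied to the “mod `N` étale theta function”, which
implies [cf. the computation applied in the proof of assertion (ii)] that for any `a·l ∈ Im_N` [where
`a ∈ ℤ`], we have `2a ≡ 0 (mod N)`."

* **`ThetaEnvData.exists_coboundary_of_biIso_over`** — EVERY automorphism `α` of `B(η)` lying over a map
  `φ` on `Π^tp_Y` (`proj(α x) = φ(proj x)`) maps `μ_N` onto itself by some `ψ ∈ Aut(μ_N)` (`μ_N` is the
  kernel of `Π^tp_Y[μ_N] ↠ Π^tp_Y`; injective on a finite set) with `ψ(η d) = η(φ d) · ∂m(φ d)` on `Π^tp_Ÿ`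
  for some `m ∈ μ_N`: `α` carries `Im(s^alg_Ÿ)` and `Im(s^Θ_η)` onto `μ_N`-CONJUGATES of themselves
  (Def 2.13 (iii)), by `inMu(a₁)` resp. `inMu(b₁)` say, and `s^alg(d) · s^Θ_η(d)⁻¹ = η(d) ∈ μ_N`, whence
  `ψ(η d) = η(φ d) · ∂(a₁ b₁⁻¹)(φ d)`. With `exists_biIso_over_aut` this is an EQUIVALENCE — the kernel form
  of the step "[`δ`] is a coboundary" behind both inclusions `(N·l·ℤ) ⋊ {±1} ⊆ Im_N ⊆ (N†·l·ℤ) ⋊ {±1}`;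
  the arithmetic input for the upper bound (Prop 1.5 (i), Prop 1.4 (ii): `2a ≡ 0 (mod N)`) is §1 data
  and is not addressed here.
HONEST FRAMING: [EtTh] is refereed; OUR kernel checks over the typed §2 interface; no side is taken on
[IUTchIII] Cor 3.12; typed ≠ discharged elsewhere.
-/

namespace Literature.AnabelianGeometry.EtaleTheta

universe u

namespace ThetaEnvData

variable {N : ℕ+} (T : ThetaEnvData.{u} N)

/-- In `Π^tp_Y[μ_N]`: `s^alg_Ÿ(d) · s^Θ_η(d)⁻¹ = η(d) ∈ μ_N` (the theta section is obtained from the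
algebraic one by subtracting `η`, p.46). Private copy of abc-iut-w4-d042's
`ThetaEnvData.sAlg_mul_sTheta_inv_eq_inMu` (`Discharge/Sec5Lem59vTransport.lean`, a §5 module not imported
into this §2 file). [cite: MochizukiEtTh2009, Def 2.13(i) p.47] -/
private theorem sAlg_mul_sTheta_inv' {η : T.PiYdd → T.mu} (hη : η ∈ T.thetaCocycles) (d : T.PiYdd) :
    T.sAlg d * (T.sTheta hη d)⁻¹ = CycEnvelope.inMu T.augY T.chi (η d) := by
  ext
  · simp [ThetaEnvData.sAlg, ThetaEnvData.sTheta]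
  · simp [ThetaEnvData.sAlg, ThetaEnvData.sTheta]

/-- Conjugation by `inMu(c)` in coordinates on the algebraic section: `(∂c(d), d)`.
[cite: MochizukiEtTh2009, Def 2.13(i) p.47] -/
theorem conj_inMu_sAlg (c : T.mu) (d : T.PiYdd) :
    MulAut.conj (CycEnvelope.inMu T.augY T.chi c) (T.sAlg d) =
      ⟨CycEnvelope.coboundary T.augY T.chi c (T.inclYdd d), T.inclYdd d⟩ := by
  rw [CycEnvelope.conj_inMu_eq_shift_coboundary, CycEnvelope.shift_apply]
  ext
  · exact one_mul _
  · rfl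

/-- Conjugation by `inMu(c)` in coordinates on the theta section: `(η(d)⁻¹ · ∂c(d), d)`.
[cite: MochizukiEtTh2009, Def 2.13(i) p.47] -/
theorem conj_inMu_sTheta {η : T.PiYdd → T.mu} (hη : η ∈ T.thetaCocycles) (c : T.mu) (d : T.PiYdd) :
    MulAut.conj (CycEnvelope.inMu T.augY T.chi c) (T.sTheta hη d) =
      ⟨(η d)⁻¹ * CycEnvelope.coboundary T.augY T.chi c (T.inclYdd d), T.inclYdd d⟩ := by
  rw [CycEnvelope.conj_inMu_eq_shift_coboundary, CycEnvelope.shift_apply]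
  rfl

/-- **Prop 2.14 (iii), BI-theta case, the cocycle criterion (necessity).** Every automorphism `α` of the
model bi-theta environment `B(η)` lying over a map `φ` on `Π^tp_Y` (`proj(α x) = φ(proj x)`) maps `μ_N`
onto itself by some `ψ ∈ Aut(μ_N)`, and the `(ψ, φ)`-transform of `η` is `η` UP TO A COBOUNDARY:
`ψ(η d) = η(φ d) · ∂m(φ d)` on `Π^tp_Ÿ` — because `α` carries `Im(s^alg_Ÿ)` and `Im(s^Θ_η)` onto
`μ_N`-CONJUGATES of themselves ("preserves the `μ_N`-conjugacy classes", p.50) and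
`s^alg(d) · s^Θ_η(d)⁻¹ = η(d)`. Together with `exists_biIso_over_aut` this is the criterion behind BOTH
inclusions `(N·l·ℤ) ⋊ {±1} ⊆ Im_N ⊆ (N†·l·ℤ) ⋊ {±1}`. [cite: MochizukiEtTh2009, Prop 2.14(iii) p.50] -/
theorem exists_coboundary_of_biIso_over {η : T.PiYdd → T.mu} (hη : η ∈ T.thetaCocycles)
    (α : (T.modelBi hη).Iso (T.modelBi hη)) (φ : T.PiX → T.PiX)
    (hα : ∀ x, ((CycEnvelope.proj T.augY T.chi (α.e x) : T.PiY) : T.PiX) =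
      φ (CycEnvelope.proj T.augY T.chi x : T.PiY)) :
    ∃ (ψ : T.mu ≃* T.mu) (m : T.mu),
      (∀ a, α.e (CycEnvelope.inMu T.augY T.chi a) = CycEnvelope.inMu T.augY T.chi (ψ a)) ∧
      ∀ d d' : T.PiYdd, φ (d : T.PiX) = d' →
        ψ (η d) = η d' * CycEnvelope.coboundary (T.aug.comp T.PiYdd.subtype) T.chi m d' := by
  have hφ1 : φ 1 = 1 := by
    have h := hα 1
    rw [map_one, map_one, OneMemClass.coe_one] at h
    exact h.symm
  -- `α` maps the cyclotome `μ_N = Ker(proj)` into itself …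
  have hright : ∀ a, (α.e (CycEnvelope.inMu T.augY T.chi a)).right = 1 := by
    intro a
    apply Subtype.ext
    have h := hα (CycEnvelope.inMu T.augY T.chi a)
    change (((α.e (CycEnvelope.inMu T.augY T.chi a)).right : T.PiY) : T.PiX) =
      φ ((1 : T.PiY) : T.PiX) at h
    rw [h, OneMemClass.coe_one, hφ1]
  have hinMu : ∀ a, α.e (CycEnvelope.inMu T.augY T.chi a) =
      CycEnvelope.inMu T.augY T.chi (α.e (CycEnvelope.inMu T.augY T.chi a)).left := fun a => by
    ext
    · rfl
    · rw [hright a]; rfl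
  -- … by a homomorphism `ψ₀`, injective hence (μ_N finite) bijective
  let ψ₀ : T.mu →* T.mu :=
    { toFun := fun a => (α.e (CycEnvelope.inMu T.augY T.chi a)).left
      map_one' := by simp
      map_mul' := fun a b => by
        simp only
        rw [map_mul, map_mul, SemidirectProduct.mul_left, hright a, map_one, MulAut.one_apply] }
  have hψ₀ : ∀ a, α.e (CycEnvelope.inMu T.augY T.chi a) = CycEnvelope.inMu T.augY T.chi (ψ₀ a) := hinMu
  have hinj : Function.Injective ψ₀ := fun a b hab => by
    have h : α.e (CycEnvelope.inMu T.augY T.chi a) = α.e (CycEnvelope.inMu T.augY T.chi b) := by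
      rw [hψ₀, hψ₀, hab]
    exact SemidirectProduct.inl_injective (α.e.injective h)
  let ψ : T.mu ≃* T.mu := MulEquiv.ofBijective ψ₀ hinj.bijective_of_finite
  have hψ : ∀ a, α.e (CycEnvelope.inMu T.augY T.chi a) = CycEnvelope.inMu T.augY T.chi (ψ a) :=
    fun a => by rw [MulEquiv.ofBijective_apply]; exact hψ₀ a
  -- the `μ_N`-offsets of `α(Im s^alg)` and `α(Im s^Θ_η)`
  have ha : T.sAlg.range.map α.e.toMulEquiv.toMonoidHom ∈
      CycEnvelope.muConjClass T.augY T.chi T.sAlg.range := by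
    have h := α.map_sAlg
    change (fun H : Subgroup T.env => H.map α.e.toMulEquiv.toMonoidHom) ''
        CycEnvelope.muConjClass T.augY T.chi T.sAlg.range =
      CycEnvelope.muConjClass T.augY T.chi T.sAlg.range at h
    rw [← h]
    exact ⟨_, CycEnvelope.self_mem_muConjClass _ _ _, rfl⟩
  obtain ⟨a₁, ha₁⟩ := ha
  have hs : (T.sTheta hη).range.map α.e.toMulEquiv.toMonoidHom ∈
      CycEnvelope.muConjClass T.augY T.chi (T.sTheta hη).range := by
    have h := α.map_sTheta
    change (fun H : Subgroup T.env => H.map α.e.toMulEquiv.toMonoidHom) ''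
        CycEnvelope.muConjClass T.augY T.chi (T.sTheta hη).range =
      CycEnvelope.muConjClass T.augY T.chi (T.sTheta hη).range at h
    rw [← h]
    exact ⟨_, CycEnvelope.self_mem_muConjClass _ _ _, rfl⟩
  obtain ⟨b₁, hb₁⟩ := hs
  refine ⟨ψ, a₁ * b₁⁻¹, hψ, fun d d' hdd' => ?_⟩
  -- element chase: `α(s^alg(d)) = inMu(a₁) s^alg(d') inMu(a₁)⁻¹`, `α(s^Θ(d)) = inMu(b₁) s^Θ(d') inMu(b₁)⁻¹`
  have h1 : α.e (T.sAlg d) ∈ T.sAlg.range.map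
      (MulAut.conj (CycEnvelope.inMu T.augY T.chi a₁)).toMonoidHom := by
    rw [← ha₁]; exact ⟨_, ⟨d, rfl⟩, rfl⟩
  obtain ⟨_, ⟨d₁, rfl⟩, hd₁⟩ := h1
  change MulAut.conj (CycEnvelope.inMu T.augY T.chi a₁) (T.sAlg d₁) = α.e (T.sAlg d) at hd₁
  have h2 : α.e (T.sTheta hη d) ∈ (T.sTheta hη).range.map
      (MulAut.conj (CycEnvelope.inMu T.augY T.chi b₁)).toMonoidHom := by
    rw [← hb₁]; exact ⟨_, ⟨d, rfl⟩, rfl⟩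
  obtain ⟨_, ⟨d₂, rfl⟩, hd₂⟩ := h2
  change MulAut.conj (CycEnvelope.inMu T.augY T.chi b₁) (T.sTheta hη d₂) = α.e (T.sTheta hη d) at hd₂
  have hd₁' : d₁ = d' := by
    apply Subtype.ext
    have h := congrArg (fun z : T.env => ((z.right : T.PiY) : T.PiX)) hd₁
    simp only [T.conj_inMu_sAlg] at h
    change (d₁ : T.PiX) = ((CycEnvelope.proj T.augY T.chi (α.e (T.sAlg d)) : T.PiY) : T.PiX) at h
    rw [hα] at h
    rw [h, ← hdd']
    rfl
  have hd₂' : d₂ = d' := by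
    apply Subtype.ext
    have h := congrArg (fun z : T.env => ((z.right : T.PiY) : T.PiX)) hd₂
    simp only [T.conj_inMu_sTheta hη] at h
    change (d₂ : T.PiX) = ((CycEnvelope.proj T.augY T.chi (α.e (T.sTheta hη d)) : T.PiY) : T.PiX) at h
    rw [hα] at h
    rw [h, ← hdd']
    rfl
  rw [hd₁'] at hd₁
  rw [hd₂'] at hd₂
  -- compare on `s^alg(d) · s^Θ(d)⁻¹ = η(d)`
  have key : CycEnvelope.inMu T.augY T.chi (ψ (η d)) =
      MulAut.conj (CycEnvelope.inMu T.augY T.chi a₁) (T.sAlg d') *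
        (MulAut.conj (CycEnvelope.inMu T.augY T.chi b₁) (T.sTheta hη d'))⁻¹ := by
    rw [← hψ, ← sAlg_mul_sTheta_inv' T hη d, map_mul, map_inv, hd₁, hd₂]
  have key2 := congrArg (fun z : T.env => z.left) key
  simp only [SemidirectProduct.left_inl] at key2
  rw [key2, T.conj_inMu_sAlg, T.conj_inMu_sTheta hη, SemidirectProduct.mul_left,
    SemidirectProduct.inv_left, ← MulAut.mul_apply, ← map_mul, mul_inv_cancel, map_one,
    MulAut.one_apply]
  change CycEnvelope.coboundary T.augY T.chi a₁ (T.inclYdd d') *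
      ((η d')⁻¹ * CycEnvelope.coboundary T.augY T.chi b₁ (T.inclYdd d'))⁻¹ =
    η d' * ((a₁ * b₁⁻¹) * (T.chi (T.aug (d' : T.PiX)) (a₁ * b₁⁻¹))⁻¹)
  have hc : ∀ c, CycEnvelope.coboundary T.augY T.chi c (T.inclYdd d') =
      c * (T.chi (T.aug (d' : T.PiX)) c)⁻¹ := fun c => rfl
  rw [hc, hc]
  simp only [map_mul, map_inv, mul_inv_rev, inv_inv]
  simp only [mul_assoc, mul_comm, mul_left_comm]

end ThetaEnvData

end Literature.AnabelianGeometry.EtaleTheta
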